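import Literature.NumberTheory.IwasawaTheory.Greenberg2006.CofiniteGenerationCriterion
import Literature.NumberTheory.IwasawaTheory.Greenberg2016.SelmerGroupStructure
import Literature.NumberTheory.EllipticCurves.IwasawaTwistedCoinvariantsProofs
import Literature.NumberTheory.EllipticCurves.IwasawaAlgebraGenericTwistFiniteProofs
import Mathlib.LinearAlgebra.Matrix.Charpoly.LinearMap
import HarnessLib

/-!
# T-42-mult in the kernel, L — P49-KERNEL (8): the LEO SQUEEZE — a cofinitely generated `Λ`-module
# whose `θ_u`-torsion has bounded exponent is killed by ONE non-zero element of `Λ`; LEO from an annihilator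

Cell `bsd-2adic` (run/shared/lean/pub/bsd-2adic/), seat `bsd-2adic-t42` GEN 19 (pen RC-337: successor remit =
`t42/DESIGN-T42-ADDENDUM-22` §A22.3, file (E1)). HONEST FRAMING: research route; THEOREMS ONLY (no `def`, no
named fact, no instance, no `sorry`); nothing booked; BSD is not proved by any of this. PARTITION: X5@2
multiplicative GV-transport rows (K4ᵐ B1·O1; the ONE remaining input LEO of `P49Kernel.prop49_of_LEO`, p671196)
× all p — reduces-the-named-input-of; bears_on K4 19922 / 19923 (`--supports stmt-BirchSwinnertonDyer-19923`).

## What (pure algebra over `Λ = ℤ_p⟦T⟧`; Greenberg LNM 1716 p. 117 «`H²(F_Σ/F, 𝒜)[θ_s]` will be finite for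
## some value of `s` … using Fact 1 about `Λ`-modules» run BACKWARDS: bounded `θ_s`-torsion ⟹ cotorsion)

For a discrete `Λ`-module `H` and its character module `X = Hom(H, ℚ/ℤ)` (Mathlib `CharacterModule`, the
canonical Pontryagin dual datum `isDualPairing_characterModule`), the twist element
`θ_u = C(u)·T + C(u − 1) = u(1 + T) − 1`, `u ≡ 1 (mod p)`, and a natural number `n ≠ 0`:

* `exists_smul_eq_nsmul_of_forall_torsionBy` — if `n` kills `H[θ]` then `n·x ∈ θ·X` for every character
  `x` (define `y` on `θH ≅ H/H[θ]` by `y(θh) = x(nh)` and extend it to `H`, `ℚ/ℤ` being injective: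
  `CharacterModule.dual_surjective_of_injective`);
* `exists_ne_zero_forall_smul_eq_zero_of_forall_exists` — if `X` is finitely generated and `n·X ⊆ θ_u·X` then
  some `r ≠ 0` kills `X`: Cayley–Hamilton for the endomorphism `n·id` with image in `(θ_u)·X`
  (`LinearMap.exists_monic_and_natDegree_eq_and_coeff_mem_pow_and_aeval_eq_zero`) gives a monic `q` with
  `q(n)·X = 0` and `q(n) ≡ n^d (mod θ_u)`; `q(n) ≠ 0` because `θ_u = u·(T − c_u)` divides no non-zero constant
  (`IwasawaAlgebra.eq_zero_of_X_sub_C_dvd_C`, `IwasawaDual.theta_eq_C_mul_X_sub_C`);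
* **`exists_ne_zero_forall_smul_eq_zero_of_nsmul_torsionBy`** — for `H` COFINITELY GENERATED
  (`Greenberg2006.IsCofinitelyGenerated`) with `n·H[θ_u] = 0`: some `r ≠ 0` in `Λ` kills `H` (characters
  separate points, `CharacterModule.exists_character_apply_ne_zero_of_ne_zero`);
* **`leo_of_exists_ne_zero_forall_smul_eq_zero`** — LEO(`𝒟`) (`Ш²(K, Σ, 𝒟)` is `Λ`-cotorsion,
  `Greenberg2016.LEO`) as soon as one non-zero `r ∈ Λ` kills `H²(K_Σ/K, 𝒟)` (`Λ` a domain).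

References: [GreenbergLNM1716] R. Greenberg, LNM 1716 (1999), proof of Prop. 4.9 pp. 116–118 (Facts about
`Λ`-modules, §3 p. 79); [Greenberg2016Selmer] §2.2 p. 6 (LEO); [Matsumura1987] Thm. 2.1 (Cayley–Hamilton).
-/

set_option autoImplicit false
set_option linter.dupNamespace false

noncomputable section

open scoped Classical Polynomial

namespace Summit.BirchSwinnertonDyer.BirchSwinnertonDyer.Theorems.P49Kernel

open NumberField IsDedekindDomain Field
  Literature.NumberTheory.EllipticCurves Literature.NumberTheory.GaloisRepresentations
  Literature.NumberTheory.IwasawaTheory.Greenberg2006 Literature.NumberTheory.IwasawaTheory.Greenberg2016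

/-! ## §1. Duality: bounded `θ`-torsion of `H` makes `n·X ⊆ θ·X` on the character module -/

section Duality

variable {Λ : Type} [CommRing Λ] {H : Type} [AddCommGroup H] [Module Λ H]

/-- **`n·H[θ] = 0 ⟹ n·x ∈ θ·X` for every character `x` of `H`.** The character `h ↦ x(n h)` vanishes on
`H[θ] = ker(θ·)`, so it factors through `H/H[θ] ≅ θH` (`LinearMap.quotKerEquivRange`); extend the resulting
character of `θH` to `H` (`ℚ/ℤ` is an injective abelian group: `CharacterModule.dual_surjective_of_injective`)
to get `y` with `y(θ h) = x(n h)`, i.e. `θ·y = n·x` in `X = Hom(H, ℚ/ℤ)`. (Greenberg: «`Im(a) = ker(b)` is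
the Pontryagin dual of `ker(X →θ X)`», p. 117, read for `H[θ]` and `X/θX`.)
[cite: GreenbergLNM1716, proof of Prop. 4.9, p. 117] -/
theorem exists_smul_eq_nsmul_of_forall_torsionBy (θ : Λ) (n : ℕ)
    (hn : ∀ h : H, θ • h = 0 → n • h = 0) (x : CharacterModule H) :
    ∃ y : CharacterModule H, θ • y = (n : Λ) • x := by
  -- multiplication by `θ` as a `ℤ`-linear map
  let L : H →ₗ[ℤ] H := ((LinearMap.lsmul Λ H θ).restrictScalars ℤ)
  have hL : ∀ h : H, L h = θ • h := fun _ ↦ rfl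
  -- the character `h ↦ x (n h)` kills `ker L = H[θ]`
  let φ : H →ₗ[ℤ] AddCircle (1 : ℚ) := ((n : Λ) • x : CharacterModule H).toIntLinearMap
  have hφ : ∀ h : H, φ h = x ((n : Λ) • h) := fun _ ↦ rfl
  have hker : LinearMap.ker L ≤ LinearMap.ker φ := by
    intro h hh
    rw [LinearMap.mem_ker] at hh ⊢
    rw [hφ, Nat.cast_smul_eq_nsmul, hn h (by rw [← hL]; exact hh), map_zero]
  -- factor through `H / H[θ] ≅ θH` and extend to `H`
  let ψ : (H ⧸ LinearMap.ker L) →ₗ[ℤ] AddCircle (1 : ℚ) := (LinearMap.ker L).liftQ φ hker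
  let y₁ : CharacterModule (LinearMap.range L) :=
    (ψ ∘ₗ (L.quotKerEquivRange).symm.toLinearMap).toAddMonoidHom
  obtain ⟨y, hy⟩ := CharacterModule.dual_surjective_of_injective
    ((LinearMap.range L).subtype) (LinearMap.range L).injective_subtype y₁
  refine ⟨y, ?_⟩
  ext h
  have hmem : L h ∈ LinearMap.range L := LinearMap.mem_range_self L h
  have h1 : y (θ • h) = y₁ ⟨L h, hmem⟩ := by
    rw [← hy]
    rfl
  rw [CharacterModule.smul_apply, h1, CharacterModule.smul_apply]
  change ψ ((L.quotKerEquivRange).symm ⟨L h, hmem⟩) = _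
  rw [LinearMap.quotKerEquivRange_symm_apply_image L h hmem]
  change φ h = _
  rw [hφ]

end Duality

/-! ## §2. Cayley–Hamilton: `n·X ⊆ θ_u·X` for a finitely generated `X` gives a non-zero annihilator -/

section CayleyHamilton

variable {p : ℕ} [Fact p.Prime]

/-- `θ_u = C(u)T + C(u−1)` is `C(u)(T + 1) − 1` (the form of `IwasawaDual.theta_eq_C_mul_X_sub_C`). [folklore] -/
theorem twistElement_eq (u : ℤ) :
    (PowerSeries.C ((u : ℤ_[p])) * PowerSeries.X + PowerSeries.C ((u : ℤ_[p]) - 1) : IwasawaAlgebra p) =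
      PowerSeries.C (u : ℤ_[p]) * (PowerSeries.X + 1) - 1 := by
  rw [map_sub, map_one, mul_add, mul_one]
  ring

/-- **`θ_u` divides no non-zero constant**: if `θ_u ∣ C(a)` in `Λ = ℤ_p⟦T⟧` (`u ≡ 1 mod p`) then `a = 0`
(`θ_u = u·(T − c_u)`, `c_u ∈ 𝔪_{ℤ_p}`, and `T − c ∣ C(a) ⟹ a = 0`). Greenberg: `ker σ_s = (θ_s)` and `σ_s` is
injective on constants. [cite: GreenbergLNM1716, §4 p. 115] -/
theorem eq_zero_of_twistElement_dvd_C {u : ℤ} (hu : (p : ℤ) ∣ u - 1) {a : ℤ_[p]}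
    (h : (PowerSeries.C ((u : ℤ_[p])) * PowerSeries.X + PowerSeries.C ((u : ℤ_[p]) - 1) : IwasawaAlgebra p) ∣
      PowerSeries.C a) : a = 0 := by
  obtain ⟨hc, hθ⟩ := IwasawaDual.theta_eq_C_mul_X_sub_C (p := p) hu
  rw [twistElement_eq, hθ] at h
  exact IwasawaAlgebra.eq_zero_of_X_sub_C_dvd_C p hc (dvd_of_mul_left_dvd h)

/-- **A finitely generated `Λ`-module with `n·X ⊆ θ_u·X` (`n ≠ 0`) is killed by a non-zero element of `Λ`.**
Cayley–Hamilton ([Matsumura] Thm. 2.1, Mathlib) for `n·id` with image in `(θ_u)·X` gives a monic `q` of degree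
`d` with lower coefficients in `(θ_u)` and `q(n)·X = 0`; `q(n) − n^d ∈ (θ_u)`, so `q(n) = 0` would make `θ_u`
divide the non-zero constant `n^d` (`eq_zero_of_twistElement_dvd_C`). This is Greenberg's "Fact 1" direction
«`X/θX` finite (here: of bounded exponent) ⟹ `X` torsion» for the prime `θ_s`. [cite: GreenbergLNM1716, §3 p. 79 and §4 p. 117] -/
theorem exists_ne_zero_forall_smul_eq_zero_of_forall_exists {X : Type} [AddCommGroup X]
    [Module (IwasawaAlgebra p) X] [Module.Finite (IwasawaAlgebra p) X] {u : ℤ} (hu : (p : ℤ) ∣ u - 1)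
    {n : ℕ} (hn : n ≠ 0)
    (h : ∀ x : X, ∃ y : X,
      (PowerSeries.C ((u : ℤ_[p])) * PowerSeries.X + PowerSeries.C ((u : ℤ_[p]) - 1) : IwasawaAlgebra p) • y =
        (n : IwasawaAlgebra p) • x) :
    ∃ r : IwasawaAlgebra p, r ≠ 0 ∧ ∀ x : X, r • x = 0 := by
  set θ : IwasawaAlgebra p :=
    PowerSeries.C ((u : ℤ_[p])) * PowerSeries.X + PowerSeries.C ((u : ℤ_[p]) - 1) with hθdef
  set I : Ideal (IwasawaAlgebra p) := Ideal.span {θ} with hI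
  -- the endomorphism `n·id` has image in `I • X`
  set f : Module.End (IwasawaAlgebra p) X := algebraMap (IwasawaAlgebra p) (Module.End (IwasawaAlgebra p) X)
    (n : IwasawaAlgebra p) with hf
  have hrange : LinearMap.range f ≤ I • (⊤ : Submodule (IwasawaAlgebra p) X) := by
    rintro z ⟨x, rfl⟩
    obtain ⟨y, hy⟩ := h x
    rw [hf, Module.algebraMap_end_apply, ← hy]
    exact Submodule.smul_mem_smul (Ideal.mem_span_singleton_self θ) Submodule.mem_top
  obtain ⟨q, hmonic, -, hcoeff, haeval⟩ :=
    LinearMap.exists_monic_and_natDegree_eq_and_coeff_mem_pow_and_aeval_eq_zero (IwasawaAlgebra p) f I hrange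
  refine ⟨q.eval (n : IwasawaAlgebra p), ?_, fun x ↦ ?_⟩
  · -- `q(n) ≡ n^d (mod θ)` and `θ ∤ n^d`
    intro hq0
    have hsum : q.eval (n : IwasawaAlgebra p) =
        (n : IwasawaAlgebra p) ^ q.natDegree +
          ∑ i ∈ Finset.range q.natDegree, q.coeff i * (n : IwasawaAlgebra p) ^ i := by
      conv_lhs => rw [hmonic.as_sum]
      rw [Polynomial.eval_add, Polynomial.eval_pow, Polynomial.eval_X, Polynomial.eval_finsetSum]
      simp only [Polynomial.eval_mul, Polynomial.eval_C, Polynomial.eval_pow, Polynomial.eval_X]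
    have hmemI : ∑ i ∈ Finset.range q.natDegree, q.coeff i * (n : IwasawaAlgebra p) ^ i ∈ I := by
      refine Ideal.sum_mem _ fun i hi ↦ Ideal.mul_mem_right _ _ ?_
      have hlt : i < q.natDegree := Finset.mem_range.mp hi
      exact Ideal.pow_le_self (Nat.sub_ne_zero_of_lt hlt) (hcoeff i)
    have hpow : (n : IwasawaAlgebra p) ^ q.natDegree ∈ I := by
      have : (n : IwasawaAlgebra p) ^ q.natDegree =
          q.eval (n : IwasawaAlgebra p) - ∑ i ∈ Finset.range q.natDegree, q.coeff i * (n : IwasawaAlgebra p) ^ i := by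
        rw [hsum, add_sub_cancel_right]
      rw [this, hq0, zero_sub]
      exact I.neg_mem hmemI
    rw [hI, Ideal.mem_span_singleton] at hpow
    have hC : ((n : IwasawaAlgebra p)) ^ q.natDegree = PowerSeries.C (((n : ℤ_[p])) ^ q.natDegree) := by
      rw [map_pow, map_natCast]
    rw [hC] at hpow
    have h0 : ((n : ℤ_[p])) ^ q.natDegree = 0 := eq_zero_of_twistElement_dvd_C hu hpow
    exact hn (by exact_mod_cast (pow_eq_zero_iff'.mp h0).1)
  · have := congrArg (fun g : Module.End (IwasawaAlgebra p) X ↦ g x) haeval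
    simp only [LinearMap.zero_apply] at this
    rw [hf, Polynomial.aeval_algebraMap_apply_eq_algebraMap_eval, Module.algebraMap_end_apply] at this
    exact this

end CayleyHamilton

/-! ## §3. The squeeze for a cofinitely generated discrete `Λ`-module -/

section Squeeze

variable {p : ℕ} [Fact p.Prime]

/-- **THE LEO SQUEEZE.** Let `H` be a COFINITELY GENERATED discrete `Λ`-module (`Λ = ℤ_p⟦T⟧`; every Pontryagin
dual finitely generated, `Greenberg2006.IsCofinitelyGenerated`), `u ≡ 1 (mod p)` and `n ≠ 0` a natural number
killing the `θ_u`-torsion `H[θ_u]` (`θ_u = C(u)T + C(u−1)`). Then ONE non-zero `r ∈ Λ` kills all of `H`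
(so every Pontryagin dual of `H`, and of every submodule of `H`, is a torsion `Λ`-module). Proof: §1 on the
character module `X` (finitely generated), §2, and characters separate points. Greenberg's use: `H = H²(F_Σ/F, 𝒜)`,
«`H²(F_Σ/F, 𝒜)[θ_s]` will be finite for some value of `s`» (p. 117). [cite: GreenbergLNM1716, §4 p. 117] -/
theorem exists_ne_zero_forall_smul_eq_zero_of_nsmul_torsionBy {H : Type} [AddCommGroup H]
    [Module (IwasawaAlgebra p) H] (hH : IsCofinitelyGenerated (IwasawaAlgebra p) H)
    {u : ℤ} (hu : (p : ℤ) ∣ u - 1) {n : ℕ} (hn : n ≠ 0)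
    (hkill : ∀ h : H,
      (PowerSeries.C ((u : ℤ_[p])) * PowerSeries.X + PowerSeries.C ((u : ℤ_[p]) - 1) : IwasawaAlgebra p) • h = 0 →
        n • h = 0) :
    ∃ r : IwasawaAlgebra p, r ≠ 0 ∧ ∀ h : H, r • h = 0 := by
  haveI : Module.Finite (IwasawaAlgebra p) (CharacterModule H) :=
    isCofinitelyGenerated_iff_module_finite_characterModule.mp hH
  obtain ⟨r, hr0, hr⟩ := exists_ne_zero_forall_smul_eq_zero_of_forall_exists (X := CharacterModule H) hu hn
    (fun x ↦ exists_smul_eq_nsmul_of_forall_torsionBy _ n hkill x)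
  refine ⟨r, hr0, fun h ↦ ?_⟩
  by_contra hne
  obtain ⟨c, hc⟩ := CharacterModule.exists_character_apply_ne_zero_of_ne_zero hne
  exact hc (by rw [← CharacterModule.smul_apply, hr c]; rfl)

/-- Variant with the torsion submodule spelled as `Submodule.torsionBy`. [cite: GreenbergLNM1716, §4 p. 117] -/
theorem exists_ne_zero_forall_smul_eq_zero_of_nsmul_torsionBy' {H : Type} [AddCommGroup H]
    [Module (IwasawaAlgebra p) H] (hH : IsCofinitelyGenerated (IwasawaAlgebra p) H)
    {u : ℤ} (hu : (p : ℤ) ∣ u - 1) {n : ℕ} (hn : n ≠ 0)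
    (hkill : ∀ h ∈ Submodule.torsionBy (IwasawaAlgebra p) H
      (PowerSeries.C ((u : ℤ_[p])) * PowerSeries.X + PowerSeries.C ((u : ℤ_[p]) - 1) : IwasawaAlgebra p),
        n • h = 0) :
    ∃ r : IwasawaAlgebra p, r ≠ 0 ∧ ∀ h : H, r • h = 0 :=
  exists_ne_zero_forall_smul_eq_zero_of_nsmul_torsionBy hH hu hn fun h hh ↦
    hkill h ((Submodule.mem_torsionBy_iff _ h).mpr hh)

end Squeeze

/-! ## §4. LEO from an annihilator of `H²(K_Σ/K, 𝒟)` -/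

section LEO

variable {K : Type} [Field K] [NumberField K] (S : Set (HeightOneSpectrum (𝓞 K)))
  {Λ : Type} [CommRing Λ] [IsDomain Λ] [TopologicalSpace Λ] [IsTopologicalRing Λ]
  {D : Type} [AddCommGroup D] [Module Λ D] [TopologicalSpace D] [DiscreteTopology D] [ContinuousSMul Λ D]
  (ρ : ContinuousRep (GaloisGroupUnramifiedOutside K S) Λ D)

omit [IsTopologicalRing Λ] in
/-- **LEO(`𝒟`) from ONE non-zero annihilator of `H²(K_Σ/K, 𝒟)`** (`Λ` a domain): every Pontryagin dual datum
`(X, toDual)` of the submodule `Ш²(K, Σ, 𝒟) ≤ H²(K_Σ/K, 𝒟)` is a torsion `Λ`-module, since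
`toDual (r·x) (s) = toDual x (r·s) = 0` and `toDual` is injective. [cite: Greenberg2016Selmer, §2.2 p. 6 L22–35] -/
theorem leo_of_exists_ne_zero_forall_smul_eq_zero (h : ∃ r : Λ, r ≠ 0 ∧ ∀ c : ρ.H 2, r • c = 0) :
    LEO S ρ := by
  obtain ⟨r, hr0, hr⟩ := h
  intro X _ _ toDual hX x
  refine ⟨⟨r, mem_nonZeroDivisors_of_ne_zero hr0⟩, ?_⟩
  change r • x = 0
  apply hX.injective
  ext s
  rw [hX.map_smul, map_zero, AddMonoidHom.zero_apply]
  have hs : r • s = 0 := Subtype.ext (by rw [Submodule.coe_smul, Submodule.coe_zero]; exact hr _)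
  rw [hs, map_zero]

omit [NumberField K] [IsTopologicalRing Λ] in
/-- The same with the cotorsion of the FULL `H²(K_Σ/K, 𝒟)` recorded as well («`H²(F_Σ/F_∞, E[p^∞])` has
`Λ`-corank `0`», Greenberg p. 114). [cite: GreenbergLNM1716, §4 p. 114] -/
theorem isCotorsion_H_two_of_exists_ne_zero_forall_smul_eq_zero
    (h : ∃ r : Λ, r ≠ 0 ∧ ∀ c : ρ.H 2, r • c = 0) : IsCotorsion Λ (ρ.H 2) := by
  obtain ⟨r, hr0, hr⟩ := h
  intro X _ _ toDual hX x
  refine ⟨⟨r, mem_nonZeroDivisors_of_ne_zero hr0⟩, ?_⟩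
  change r • x = 0
  apply hX.injective
  ext s
  rw [hX.map_smul, hr, map_zero, map_zero, AddMonoidHom.zero_apply]

end LEO

end Summit.BirchSwinnertonDyer.BirchSwinnertonDyer.Theorems.P49Kernel

end
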